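import Mathlib
import Summits.KontsevichZagierPeriods.KontsevichZagierPeriods.Theses.InverseLandau
import Literature.NumberTheory.Transcendental.KZCalculus
import Literature.NumberTheory.Transcendental.KZLogCalculusProofs
import Literature.NumberTheory.Transcendental.SemialgebraicRpow
import Literature.NumberTheory.Transcendental.KZDominatedFamilyRelations
import Summits.KontsevichZagierPeriods.KontsevichZagierPeriods.Theorems.InverseLandauTateLiftingConeEngine
import Summits.KontsevichZagierPeriods.KontsevichZagierPeriods.Theorems.InverseLandauTateLiftingPullback
import Summits.KontsevichZagierPeriods.KontsevichZagierPeriods.Theorems.FermatIsogenyBetaLinearSectorStubBandNewtonLeibnizEngineAux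

/-!
# `TateLifting` (stmt-KontsevichZagierPeriods-9129), line `Sketch` —
# stub `stub_wheelBodyToAffineChart`: the body of the wheel `W₃ = K₄` in the affine chart

Stub `stub_wheelBodyToAffineChart` of the crux `TateLifting` (kernel form of the Kontsevich–Zagier
period conjecture), verbatim the item `WheelBodyToAffineChart` (stmt-KontsevichZagierPeriods-4418)
of route SiegelTamagawa. Let `F(x) = Σ_T Π_{e ∈ T} x_e` be the Kirchhoff (spanning-tree) polynomial
of the complete graph `K₄` (the wheel `W₃`): `16` cubic monomials in the `6` edge variables
`x₀, …, x₅`, homogeneous of degree `3`. For the representation `r = [{x > 0, F(x) < 1} ⊆ ℝ⁶, 6]`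
("six times the volume of the body `F < 1` in the positive orthant") and the representation
`r' = [{y > 0} ⊆ ℝ⁵, F(y, 1)⁻²]` (the same number in the affine chart `x₅ = 1` of the projective
space of edge weights) we prove `KZ.Equivalent r r'`, i.e. `[r] − [r'] ∈ KZ.relations`
(`tateLifting_wheelBodyToAffineChart`), inside the calculus of `KZCalculus.lean` — no
transcendence input, two printed moves and null-set bookkeeping:

* rule (2), ONE change of variables along the cone chart `Ψ(y, t) = (t·y₀, …, t·y₄, t)` from the
  open band `C = {(y, t) | y > 0, 0 < t < F(y,1)^{-1/3}}` onto `{x > 0, F(x) < 1}` (homogeneity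
  `F(t y, t) = t³ F(y, 1)`; inverse `x ↦ (x₀/x₅, …, x₄/x₅, x₅)`; upper-triangular Jacobian of
  determinant `t⁵`, `Cone.exists_hasFDerivAt_det`), packaged by the honest pull-back engine
  `tateLifting_pullback`: `[r] − [C, t⁵ · 6] ∈ relations`;
* rule (3), ONE Newton–Leibniz move along `t` over the base `{y > 0}` with edges `a = 0`,
  `b(y) = F(y,1)^{-1/3}` (a `ℚ`-semialgebraic function: cube root of a positive rational function,
  `IsSemialgebraicFunOn.rpow_ratCast`), primitive `G(y, t) = t⁶`, `∂G/∂t = 6t⁵`, boundary values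
  `G(y, b y) − G(y, 0) = F(y,1)⁻²`: `[closed band, 6t⁵] − [r'] ∈ relations`;
* the closed band `{y > 0, 0 ≤ t ≤ b(y)}` and the open band `C` differ by the null set
  `{t = 0} ∪ graph(b)` (rule (1), `KZ.IntegralRep.of_sub_of_restrict_mem_relations`), and on `C` the
  two integrands `t⁵ · 6` and `6t⁵` agree (`KZ.of_sub_of_mem_relations_of_eqOn`).

No definitions are introduced: the chart, the edge `b` and the band representation are written out
literally (`WheelBody.exists_bandRep`).

References: M. Kontsevich, D. Zagier, *Periods* (2001), §1.2 rules (1)–(3); J. Bochnak, M. Coste,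
M.-F. Roy, *Real Algebraic Geometry* (1998), §2.2 (Tarski–Seidenberg, Prop. 2.2.6).
-/

noncomputable section

open MeasureTheory Set
open Literature.NumberTheory.Transcendental
open Literature.ModelTheory.ExponentialFields (IsSemialgebraic)
open MvPolynomial (aeval X)

namespace Summit.KontsevichZagierPeriods.InverseLandau

namespace WheelBody

/-! ### Semialgebraic and elementary preliminaries -/

/-- The edge `b = (1/g)^{1/3}` of the band is a `ℚ`-semialgebraic function wherever `1/g` is
`ℚ`-semialgebraic and `g > 0` (rational powers of positive semialgebraic functions).
[cite: BochnakCosteRoy1998, Prop. 2.2.6] -/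
theorem isSemialgebraicFunOn_edge {τ : Set (Fin 5 → ℝ)} {g : (Fin 5 → ℝ) → ℝ}
    (hτ : IsSemialgebraic ℚ τ) (hg : IsSemialgebraicFunOn ℚ τ fun y => 1 / g y)
    (hpos : ∀ y ∈ τ, 0 < g y) :
    IsSemialgebraicFunOn ℚ τ fun y => (1 / g y) ^ (3 : ℝ)⁻¹ :=
  (hg.rpow_ratCast hτ (fun y hy => by have := hpos y hy; positivity) (1 / 3)).congr
    fun y _ => by norm_num

open Summit.KontsevichZagierPeriods.FermatIsogeny in
/-- The open band `{(y, t) | y ∈ τ, 0 < t < b y}` under a `ℚ`-semialgebraic edge `b` is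
`ℚ`-semialgebraic (strict hypograph of `b`, `BetaLinearSector.engine_isSemialgebraic_setOf_lt`,
meets the half-space `{t > 0}`). [cite: BochnakCosteRoy1998, §2.2] -/
theorem isSemialgebraic_openBand {τ : Set (Fin 5 → ℝ)} {b : (Fin 5 → ℝ) → ℝ}
    (hb : IsSemialgebraicFunOn ℚ τ b) :
    IsSemialgebraic ℚ {w : Fin 6 → ℝ | Fin.init w ∈ τ ∧ 0 < w (Fin.last 5) ∧
      w (Fin.last 5) < b (Fin.init w)} := by
  have h0 : IsSemialgebraic ℚ {w : Fin 6 → ℝ | 0 < w (Fin.last 5)} := by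
    simpa using Literature.ModelTheory.ExponentialFields.isSemialgebraic_setOf_eval_pos (k := ℚ)
      (R := ℝ) (X (Fin.last 5) : MvPolynomial (Fin 6) ℚ)
  convert h0.inter (BetaLinearSector.engine_isSemialgebraic_setOf_lt hb) using 1
  ext w
  simp only [mem_setOf_eq, mem_inter_iff]
  tauto

/-- `t < (1/c)^{1/3} ↔ t³ c < 1` for `t, c > 0`. [folklore] -/
theorem lt_edge_iff {t c : ℝ} (ht : 0 < t) (hc : 0 < c) :
    t < (1 / c) ^ (3 : ℝ)⁻¹ ↔ t ^ 3 * c < 1 := by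
  rw [Real.lt_rpow_inv_iff_of_pos ht.le (by positivity) (by norm_num : (0 : ℝ) < 3),
    lt_div_iff₀ hc, show (3 : ℝ) = ((3 : ℕ) : ℝ) by norm_num, Real.rpow_natCast]

/-- `((1/c)^{1/3})⁶ − 0⁶ = 1/c²` for `c > 0` (the boundary values of the primitive `t⁶`).
[folklore] -/
theorem edge_pow_six {c : ℝ} (hc : 0 < c) :
    ((1 / c) ^ (3 : ℝ)⁻¹) ^ 6 - 0 ^ 6 = 1 / c ^ 2 := by
  have h0 : 0 ≤ 1 / c := by positivity
  rw [← Real.rpow_natCast _ 6, ← Real.rpow_mul h0]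
  norm_num

/-! ### The cone chart `Ψ(y, t) = (t·y, t)` -/

/-- The coordinates of the cone chart `Ψ w = (w₅ w₀, …, w₅ w₄, w₅)`. [folklore] -/
theorem chart_apply (w : Fin 6 → ℝ) :
    (Fin.snoc (fun k : Fin 5 => w (Fin.last 5) * w (Fin.castSucc k)) (w (Fin.last 5)) :
        Fin 6 → ℝ) 0 = w 5 * w 0 ∧
      (Fin.snoc (fun k : Fin 5 => w (Fin.last 5) * w (Fin.castSucc k)) (w (Fin.last 5)) :
        Fin 6 → ℝ) 1 = w 5 * w 1 ∧
      (Fin.snoc (fun k : Fin 5 => w (Fin.last 5) * w (Fin.castSucc k)) (w (Fin.last 5)) :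
        Fin 6 → ℝ) 2 = w 5 * w 2 ∧
      (Fin.snoc (fun k : Fin 5 => w (Fin.last 5) * w (Fin.castSucc k)) (w (Fin.last 5)) :
        Fin 6 → ℝ) 3 = w 5 * w 3 ∧
      (Fin.snoc (fun k : Fin 5 => w (Fin.last 5) * w (Fin.castSucc k)) (w (Fin.last 5)) :
        Fin 6 → ℝ) 4 = w 5 * w 4 ∧
      (Fin.snoc (fun k : Fin 5 => w (Fin.last 5) * w (Fin.castSucc k)) (w (Fin.last 5)) :
        Fin 6 → ℝ) 5 = w 5 :=
  ⟨rfl, rfl, rfl, rfl, rfl, rfl⟩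

/-- The cone chart is injective on every set on which the last coordinate does not vanish.
[folklore] -/
theorem chart_injOn {D : Set (Fin 6 → ℝ)} (hD : ∀ w ∈ D, w (Fin.last 5) ≠ 0) :
    InjOn (fun w : Fin 6 → ℝ => (Fin.snoc (fun k : Fin 5 => w (Fin.last 5) * w (Fin.castSucc k))
      (w (Fin.last 5)) : Fin 6 → ℝ)) D := by
  -- adapted from `Cone.exists_pullback` (Theorems/InverseLandauTateLiftingConeEngine.lean)
  intro w₁ hw₁ w₂ _ h
  have h0 := hD w₁ hw₁
  have hlast : w₁ (Fin.last 5) = w₂ (Fin.last 5) := by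
    simpa only [Fin.snoc_last] using congrFun h (Fin.last 5)
  funext j
  induction j using Fin.lastCases with
  | last => exact hlast
  | cast k =>
    have hk := congrFun h (Fin.castSucc k)
    simp only [Fin.snoc_castSucc] at hk
    rw [← hlast] at hk
    exact mul_left_cancel₀ h0 hk

/-- **The cone chart maps the open band onto the body.** If `F (Ψ w) = w₅³ · g (y)` (`y = init w`,
homogeneity of degree `3`) and `g > 0` on `τ = {y > 0}`, then `Ψ` maps
`{(y, t) | y > 0, 0 < t < (1/g y)^{1/3}}` onto `{x > 0, F x < 1}` (inverse
`x ↦ (x₀/x₅, …, x₄/x₅, x₅)`). [folklore] -/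
theorem image_chart {σ : Set (Fin 6 → ℝ)} {τ : Set (Fin 5 → ℝ)} {F : (Fin 6 → ℝ) → ℝ}
    {g : (Fin 5 → ℝ) → ℝ} (hσ : ∀ z, z ∈ σ ↔ (∀ i, 0 < z i) ∧ F z < 1)
    (hτ : ∀ y, y ∈ τ ↔ ∀ i, 0 < y i)
    (hF : ∀ w : Fin 6 → ℝ, F (Fin.snoc (fun k : Fin 5 => w (Fin.last 5) * w (Fin.castSucc k))
      (w (Fin.last 5))) = w (Fin.last 5) ^ 3 * g (Fin.init w))
    (hg : ∀ y ∈ τ, 0 < g y) :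
    (fun w : Fin 6 → ℝ => (Fin.snoc (fun k : Fin 5 => w (Fin.last 5) * w (Fin.castSucc k))
      (w (Fin.last 5)) : Fin 6 → ℝ)) ''
      {w | Fin.init w ∈ τ ∧ 0 < w (Fin.last 5) ∧
        w (Fin.last 5) < (1 / g (Fin.init w)) ^ (3 : ℝ)⁻¹} = σ := by
  ext z
  constructor
  · rintro ⟨w, ⟨hwτ, hw0, hwb⟩, rfl⟩
    refine (hσ _).2 ⟨fun i => ?_, ?_⟩
    · induction i using Fin.lastCases with
      | last => simpa only [Fin.snoc_last] using hw0
      | cast k =>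
        simp only [Fin.snoc_castSucc]
        exact mul_pos hw0 ((hτ _).1 hwτ k)
    · rw [hF, ← lt_edge_iff hw0 (hg _ hwτ)]
      exact hwb
  · intro hz
    obtain ⟨hzpos, hzF⟩ := (hσ z).1 hz
    have h5 : 0 < z (Fin.last 5) := hzpos _
    set w : Fin 6 → ℝ := Fin.snoc (fun i : Fin 5 => z (Fin.castSucc i) / z (Fin.last 5))
      (z (Fin.last 5)) with hw
    have hΦw : (Fin.snoc (fun k : Fin 5 => w (Fin.last 5) * w (Fin.castSucc k)) (w (Fin.last 5)) :
        Fin 6 → ℝ) = z := by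
      funext j
      induction j using Fin.lastCases with
      | last => simp only [hw, Fin.snoc_last]
      | cast k =>
        simp only [hw, Fin.snoc_last, Fin.snoc_castSucc]
        exact mul_div_cancel₀ _ h5.ne'
    have hlast : w (Fin.last 5) = z (Fin.last 5) := by simp only [hw, Fin.snoc_last]
    have hwτ : Fin.init w ∈ τ := (hτ _).2 fun i => by
      rw [hw, Fin.init_snoc]
      exact div_pos (hzpos _) h5
    refine ⟨w, ⟨hwτ, hlast ▸ h5, ?_⟩, hΦw⟩
    rw [lt_edge_iff (hlast ▸ h5) (hg _ hwτ), ← hF w, hΦw]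
    exact hzF

/-! ### The Newton–Leibniz move along `t` -/

/-- The closed band minus the open band is null: it lies in the hyperplane `{t = 0}` union the
graph of the edge `b`. [folklore] -/
theorem volume_band_diff_eq_zero {τ : Set (Fin 5 → ℝ)} {b : (Fin 5 → ℝ) → ℝ}
    (hb : IsSemialgebraicFunOn ℚ τ b) :
    volume (KZlog.band τ (fun _ => 0) b \
      {w : Fin 6 → ℝ | Fin.init w ∈ τ ∧ 0 < w (Fin.last 5) ∧
        w (Fin.last 5) < b (Fin.init w)}) = 0 := by
  refine measure_mono_null (fun w hw => ?_)
    (measure_union_null (KZ.volume_setOf_last_eq_zero (n := 5) 0) (KZ.volume_graph_eq_zero hb))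
  obtain ⟨⟨hτ, h0, hb'⟩, hC⟩ := hw
  simp only [mem_setOf_eq, not_and, not_lt] at hC
  simp only [mem_union, mem_setOf_eq]
  rcases h0.lt_or_eq with h | h
  · exact Or.inr ⟨hτ, le_antisymm hb' (hC hτ h)⟩
  · exact Or.inl h.symm

/-- **The honest band representation `[{y ∈ τ, 0 ≤ t ≤ b y}, 6t⁵]`** exists as soon as `6t⁵` is
integrable on the open band (the closed band exceeds it by a null set) and the edge `b` is
`ℚ`-semialgebraic on the `ℚ`-semialgebraic base `τ`. [cite: KontsevichZagier2001, §1.1] -/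
theorem exists_bandRep {τ : Set (Fin 5 → ℝ)} {b : (Fin 5 → ℝ) → ℝ} (hτ : IsSemialgebraic ℚ τ)
    (hb : IsSemialgebraicFunOn ℚ τ b)
    (hint : IntegrableOn (fun z : Fin 6 → ℝ => 6 * z (Fin.last 5) ^ 5)
      {w : Fin 6 → ℝ | Fin.init w ∈ τ ∧ 0 < w (Fin.last 5) ∧ w (Fin.last 5) < b (Fin.init w)}) :
    ∃ R : KZ.IntegralRep 6, R.domain = KZlog.band τ (fun _ => 0) b ∧
      R.integrand = fun z => 6 * z (Fin.last 5) ^ 5 := by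
  have hB : IsSemialgebraic ℚ (KZlog.band τ (fun _ => (0 : ℝ)) b) :=
    KZlog.isSemialgebraic_band ((isSemialgebraicFunOn_aeval hτ 0).congr fun y _ => by simp) hb
  have hsub : {w : Fin 6 → ℝ | Fin.init w ∈ τ ∧ 0 < w (Fin.last 5) ∧
      w (Fin.last 5) < b (Fin.init w)} ⊆ KZlog.band τ (fun _ => 0) b :=
    fun w hw => ⟨hw.1, hw.2.1.le, hw.2.2.le⟩
  have hintB : IntegrableOn (fun z : Fin 6 → ℝ => 6 * z (Fin.last 5) ^ 5)
      (KZlog.band τ (fun _ => 0) b) :=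
    hint.congr_set_ae (ae_eq_set.2 ⟨volume_band_diff_eq_zero hb,
      measure_mono_null (fun w hw => (hw.2 (hsub hw.1)).elim) measure_empty⟩)
  exact ⟨⟨KZlog.band τ (fun _ => 0) b, fun z => 6 * z (Fin.last 5) ^ 5, hB,
    (isSemialgebraicFunOn_aeval hB (6 * X (Fin.last 5) ^ 5)).congr fun z _ => by simp, hintB⟩,
    rfl, rfl⟩

/-- **The Newton–Leibniz move** (rule (3)) along the last coordinate `t` over the base `r'.domain`
with edges `a = 0 ≤ b = (1/g)^{1/3}` and primitive `G(y, t) = t⁶`: for the band representation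
`R = [{y ∈ r'.domain, 0 ≤ t ≤ b y}, 6t⁵]` and a base representation `r'` with integrand `1/g²`
(`= G(y, b y) − G(y, 0)`) on its domain, `[R] − [r'] ∈ KZ.relations`.
[cite: KontsevichZagier2001, §1.2 rule (3)] -/
theorem band_sub_base_mem (R : KZ.IntegralRep 6) (r' : KZ.IntegralRep 5) {g : (Fin 5 → ℝ) → ℝ}
    (hg : IsSemialgebraicFunOn ℚ r'.domain fun y => 1 / g y) (hpos : ∀ y ∈ r'.domain, 0 < g y)
    (hRd : R.domain = KZlog.band r'.domain (fun _ => 0) fun y => (1 / g y) ^ (3 : ℝ)⁻¹)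
    (hRi : R.integrand = fun z => 6 * z (Fin.last 5) ^ 5)
    (hr'i : EqOn r'.integrand (fun y => 1 / g y ^ 2) r'.domain) :
    KZ.of R - KZ.of r' ∈ KZ.relations := by
  refine KZ.newtonLeibnizRel_subset_relations ⟨5, R, r', fun _ => 0,
    fun y => (1 / g y) ^ (3 : ℝ)⁻¹, fun z => z (Fin.last 5) ^ 6,
    (isSemialgebraicFunOn_aeval R.isSemialgebraic_domain (X (Fin.last 5) ^ 6)).congr
      fun z _ => by simp,
    (isSemialgebraicFunOn_aeval r'.isSemialgebraic_domain 0).congr fun y _ => by simp,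
    isSemialgebraicFunOn_edge r'.isSemialgebraic_domain hg hpos,
    fun y hy => Real.rpow_nonneg (by have := hpos y hy; positivity) _, by rw [hRd]; rfl,
    fun y _ => ?_, fun y _ t _ => ?_, fun y hy => ?_, rfl⟩
  · simp only [Fin.snoc_last]
    exact (continuous_pow 6).continuousOn
  · rw [hRi]
    simp only [Fin.snoc_last]
    simpa using hasDerivAt_pow 6 t
  · rw [hr'i hy]
    simp only [Fin.snoc_last]
    exact (edge_pow_six (hpos y hy)).symm

end WheelBody

open WheelBody in
/-- **WHEEL BODY TO AFFINE CHART** (stub `stub_wheelBodyToAffineChart` of line `Sketch`; item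
`WheelBodyToAffineChart`, stmt-KontsevichZagierPeriods-4418, route SiegelTamagawa). For the
Kirchhoff polynomial `F` of `K₄` (16 cubic monomials in `x₀, …, x₅`), the representation
`[{x > 0, F(x) < 1}, 6]` and the affine-chart representation `[{y > 0} ⊆ ℝ⁵, F(y,1)⁻²]` are
equivalent in the Kontsevich–Zagier calculus: one change of variables along the cone chart
`(y, t) ↦ (t y, t)` (Jacobian `t⁵`, `tateLifting_pullback`), one Newton–Leibniz move in `t` with
primitive `t⁶` and upper edge `F(y,1)^{-1/3}` (`WheelBody.band_sub_base_mem`), and null-set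
bookkeeping between the open and the closed band. [cite: KontsevichZagier2001, §1.2] -/
theorem tateLifting_wheelBodyToAffineChart :
    ∀ (r : KZ.IntegralRep 6) (r' : KZ.IntegralRep 5), r.domain = {x : Fin 6 → ℝ | (∀ i, 0 < x i) ∧ x 0 * x 1 * x 3 + x 0 * x 1 * x 4 + x 0 * x 1 * x 5 + x 0 * x 2 * x 3 + x 0 * x 2 * x 4 + x 0 * x 2 * x 5 + x 0 * x 3 * x 5 + x 0 * x 4 * x 5 + x 1 * x 2 * x 3 + x 1 * x 2 * x 4 + x 1 * x 2 * x 5 + x 1 * x 3 * x 4 + x 1 * x 4 * x 5 + x 2 * x 3 * x 4 + x 2 * x 3 * x 5 + x 3 * x 4 * x 5 < 1} → Set.EqOn r.integrand (fun _ => 6) r.domain → r'.domain = {x | ∀ i, 0 < x i} → Set.EqOn r'.integrand (fun x => 1 / (x 0 * x 1 * x 3 + x 0 * x 1 * x 4 + x 0 * x 1 + x 0 * x 2 * x 3 + x 0 * x 2 * x 4 + x 0 * x 2 + x 0 * x 3 + x 0 * x 4 + x 1 * x 2 * x 3 + x 1 * x 2 * x 4 + x 1 * x 2 + x 1 * x 3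 * x 4 + x 1 * x 4 + x 2 * x 3 * x 4 + x 2 * x 3 + x 3 * x 4) ^ 2) r'.domain → KZ.Equivalent r r' := by
  intro r r' hrd hri hr'd hr'i
  -- the dehomogenised Kirchhoff polynomial `g = F(·, 1)` and its `ℚ`-polynomial
  set g : (Fin 5 → ℝ) → ℝ := fun x => x 0 * x 1 * x 3 + x 0 * x 1 * x 4 + x 0 * x 1 +
    x 0 * x 2 * x 3 + x 0 * x 2 * x 4 + x 0 * x 2 + x 0 * x 3 + x 0 * x 4 + x 1 * x 2 * x 3 +
    x 1 * x 2 * x 4 + x 1 * x 2 + x 1 * x 3 * x 4 + x 1 * x 4 + x 2 * x 3 * x 4 + x 2 * x 3 +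
    x 3 * x 4 with hg_def
  set P : MvPolynomial (Fin 5) ℚ := X 0 * X 1 * X 3 + X 0 * X 1 * X 4 + X 0 * X 1 +
    X 0 * X 2 * X 3 + X 0 * X 2 * X 4 + X 0 * X 2 + X 0 * X 3 + X 0 * X 4 + X 1 * X 2 * X 3 +
    X 1 * X 2 * X 4 + X 1 * X 2 + X 1 * X 3 * X 4 + X 1 * X 4 + X 2 * X 3 * X 4 + X 2 * X 3 +
    X 3 * X 4 with hP_def
  have hP : ∀ y : Fin 5 → ℝ, aeval y P = g y := fun y => by
    simp only [hP_def, hg_def, map_add, map_mul, MvPolynomial.aeval_X]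
  have hτ : ∀ y, y ∈ r'.domain ↔ ∀ i, 0 < y i := fun y => by rw [hr'd]; rfl
  have hpos : ∀ y ∈ r'.domain, 0 < g y := fun y hy => by
    have h := (hτ y).1 hy
    have h0 := h 0; have h1 := h 1; have h2 := h 2; have h3 := h 3; have h4 := h 4
    simp only [hg_def]
    positivity
  have hginv : IsSemialgebraicFunOn ℚ r'.domain fun y => 1 / g y :=
    (isSemialgebraicFunOn_aeval_div_aeval r'.isSemialgebraic_domain 1 P fun y hy => by
      rw [hP]; exact (hpos y hy).ne').congr fun y _ => by simp only [hP, map_one]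
  have hb : IsSemialgebraicFunOn ℚ r'.domain fun y => (1 / g y) ^ (3 : ℝ)⁻¹ :=
    isSemialgebraicFunOn_edge r'.isSemialgebraic_domain hginv hpos
  -- the open band `C` and the cone chart `Ψ`
  set C : Set (Fin 6 → ℝ) := {w | Fin.init w ∈ r'.domain ∧ 0 < w (Fin.last 5) ∧
    w (Fin.last 5) < (1 / g (Fin.init w)) ^ (3 : ℝ)⁻¹} with hC_def
  have hC : IsSemialgebraic ℚ C := isSemialgebraic_openBand hb
  set Ψ : (Fin 6 → ℝ) → (Fin 6 → ℝ) := fun w =>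
    Fin.snoc (fun k : Fin 5 => w (Fin.last 5) * w (Fin.castSucc k)) (w (Fin.last 5)) with hΨ
  -- homogeneity: `F (Ψ w) = w₅³ g (init w)`
  have hσ : ∀ z, z ∈ r.domain ↔ (∀ i, 0 < z i) ∧ (fun x : Fin 6 → ℝ => x 0 * x 1 * x 3 +
      x 0 * x 1 * x 4 + x 0 * x 1 * x 5 + x 0 * x 2 * x 3 + x 0 * x 2 * x 4 + x 0 * x 2 * x 5 +
      x 0 * x 3 * x 5 + x 0 * x 4 * x 5 + x 1 * x 2 * x 3 + x 1 * x 2 * x 4 + x 1 * x 2 * x 5 +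
      x 1 * x 3 * x 4 + x 1 * x 4 * x 5 + x 2 * x 3 * x 4 + x 2 * x 3 * x 5 + x 3 * x 4 * x 5) z <
      1 := fun z => by rw [hrd]; rfl
  have himage : Ψ '' C = r.domain := by
    refine image_chart hσ hτ (fun w => ?_) hpos
    obtain ⟨e0, e1, e2, e3, e4, e5⟩ := chart_apply w
    simp only [e0, e1, e2, e3, e4, e5]
    simp only [hg_def, Fin.init, show (Fin.castSucc (0 : Fin 5) : Fin 6) = 0 from rfl,
      show (Fin.castSucc (1 : Fin 5) : Fin 6) = 1 from rfl,
      show (Fin.castSucc (2 : Fin 5) : Fin 6) = 2 from rfl,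
      show (Fin.castSucc (3 : Fin 5) : Fin 6) = 3 from rfl,
      show (Fin.castSucc (4 : Fin 5) : Fin 6) = 4 from rfl, show (Fin.last 5 : Fin 6) = 5 from rfl]
    ring
  -- (1) the honest pull-back `r₁ = [C, t⁵ · 6]` along `Ψ`
  choose L hL hLdet using fun w : Fin (5 + 1) → ℝ => Cone.exists_hasFDerivAt_det (n := 5) w
  obtain ⟨r₁, hr₁d, hr₁i, hpull⟩ := tateLifting_pullback 6 r C Ψ L (fun w => w (Fin.last 5) ^ 5)
    hC (Cone.isSemialgebraicMapOn_chart hC) (fun w _ => (hL w).hasFDerivWithinAt)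
    (chart_injOn fun w hw => hw.2.1.ne') himage
    ((isSemialgebraicFunOn_aeval hC (X (Fin.last 5) ^ 5 : MvPolynomial (Fin 6) ℚ)).congr
      fun w _ => by simp)
    (fun w hw => by rw [hLdet]; exact (abs_of_nonneg (pow_nonneg hw.2.1.le 5)).symm)
  -- (2) the honest closed-band representation `R = [{y > 0, 0 ≤ t ≤ b y}, 6t⁵]`
  have hCmeas : MeasurableSet C := IsSemialgebraic.measurableSet_holds hC
  have heqC : EqOn r₁.integrand (fun z => 6 * z (Fin.last 5) ^ 5) C := fun w hw => by
    rw [hr₁i]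
    dsimp only
    rw [hri (himage ▸ mem_image_of_mem Ψ hw), mul_comm]
  have hint : IntegrableOn (fun z : Fin 6 → ℝ => 6 * z (Fin.last 5) ^ 5) C :=
    (hr₁d ▸ r₁.integrableOn).congr_fun heqC hCmeas
  obtain ⟨R, hRd, hRi⟩ := exists_bandRep r'.isSemialgebraic_domain hb hint
  have hCR : C ⊆ R.domain := by
    rw [hRd]
    exact fun w hw => ⟨hw.1, hw.2.1.le, hw.2.2.le⟩
  -- (3) the four relations
  have h₁ : KZ.of R - KZ.of (R.restrict C hC hCR) ∈ KZ.relations :=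
    R.of_sub_of_restrict_mem_relations hC hCR (by rw [hRd]; exact volume_band_diff_eq_zero hb)
  have h₂ : KZ.of (R.restrict C hC hCR) - KZ.of r₁ ∈ KZ.relations :=
    KZ.of_sub_of_mem_relations_of_eqOn (by rw [hr₁d]; rfl) fun w hw => by
      rw [KZ.IntegralRep.integrand_restrict, hRi, heqC hw]
  have h₃ : KZ.of R - KZ.of r' ∈ KZ.relations := band_sub_base_mem R r' hginv hpos hRd hRi hr'i
  have key : KZ.of r - KZ.of r' = (KZ.of r - KZ.of r₁) - (KZ.of (R.restrict C hC hCR) - KZ.of r₁) -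
      (KZ.of R - KZ.of (R.restrict C hC hCR)) + (KZ.of R - KZ.of r') := by
    abel
  show KZ.of r - KZ.of r' ∈ KZ.relations
  rw [key]
  exact add_mem (sub_mem (sub_mem hpull h₂) h₁) h₃

end Summit.KontsevichZagierPeriods.InverseLandau

end
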